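import Summits.BirchSwinnertonDyer.BirchSwinnertonDyer.Theorems.RamifiedSevenEllipticUnitsIndexOfLeaf
import Summits.BirchSwinnertonDyer.BirchSwinnertonDyer.Theorems.RamifiedSevenEllipticUnitsStrictTorsionOfGZK
import Summits.BirchSwinnertonDyer.BirchSwinnertonDyer.Theorems.RamifiedSevenEllipticUnitsFrameDataSevenOfGZK
import HarnessLib

set_option linter.dupNamespace false
set_option autoImplicit false

/-!
# Route `RamifiedSevenEllipticUnits` (rung K7r): crux #2 `EllipticUnitIndexSeven`
# (stmt-BirchSwinnertonDyer-19143) ⟺ the rung leaf, modulo the route's PUBLISHED FACTS ONLY; and at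
# every single member `W ∈ 𝒞₇`: `(R-EU)@7 at W ⟺ BSD(W, 7)` modulo four classical facts
# (`--supports 19143`)

Cell `bsd-cm`, seat `bsd-cm-k7r-c2` (gen 3). HONEST FRAMING: nothing here closes the crux or the
leaf; BSD is not proved by any of this. State of the route's cone on 2026-08-26 ~08:00Z: crux #4
`StrictControlSeven` is a theorem (`StrictControlSeven_proof`, k7r-c4 p429067); crux #3
`StrictTorsionSeven` follows from GZK (`strictTorsionSeven_of_GZK`, k7r-c4 p430232) and is EQUIVALENT
fact-free to strict `7^∞`-Selmer finiteness on 𝒞₇ (k7r-c3 p431290); the frame data follow from GZK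
(`frameDataSevenOfGZK_proof`, `frameDataSeven_of_GZK`). This file records what that leaves of crux #2:

* §1 MEMBER LEVEL. `bsdp_seven_of_ellipticUnitIndexAt`: for ONE globally minimal `W ∈ 𝒞₇`,
  `(R-EU)@7 at W ⟹ BSD(W, 7)` granted only modularity (`hmod`), Gross–Zagier I.(7.3) (`hGZ`), GZK
  (`hGZK`) and Cassels (`hCassels`) — the O11 consumer `O11.bsdp_of_halves` with (R-tors), (R-ctrl)
  and the frame data DISCHARGED by the theorems above. With gen 3's converse
  `ellipticUnitIndexAt_seven_of_bsdp` (p430259): **`ellipticUnitIndexAt_seven_iff_bsdp` — at every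
  member the crux's instance IS Miller's `BSD(W, 7)`, modulo those four facts.**
* §2 CLASS LEVEL. `forall_bsdp_seven_of_ellipticUnitIndexSeven`,
  `ellipticUnitIndexSeven_iff_forall_bsdp_seven_of_GZK` (crux ⟺ `BSD(·, 7)` on 𝒞₇ modulo the four
  facts) and `ellipticUnitIndexSeven_iff_cmRamifiedSeven_of_publishedFacts` (crux ⟺ rung LEAF
  `X12.CMRamifiedSeven` modulo the route's support item `PublishedFactsSeven` alone: (→) is the
  route composition with cruxes #3/#4 discharged (= k7r-c3's `cmRamifiedSeven_of_ellipticUnitIndexSeven`,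
  p431290), (←) is gen 3's `ellipticUnitIndexSeven_of_cmRamifiedSeven`).

So K7r's live cone is ONE crux, and that crux is the leaf up to named facts: the route no longer
decomposes the leaf (planner's call: D-0019 thin-route rule / FRONTIER disposition D93); its
bankable content is per member (Route U `X12/O11/RouteU*`, `…Member79`, census26, W-79A).

References: [Miller2011LMS] Def. 1.1; [GrossZagier1986] Thm. I.(7.3); [Cassels1965ArithmeticVIII];
[Kolyvagin1990] (GZK, as the named fact `rank_eq_analyticRank_of_analyticRank_le_one`).
-/

noncomputable section

open scoped Classical

open WeierstrassCurve NumberField IsDedekindDomain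
  Literature.NumberTheory.EllipticCurves
  Literature.NumberTheory.EllipticCurves.Rank1Residual
  Summit.BirchSwinnertonDyer.Rank1Residual.X12
  Summit.BirchSwinnertonDyer.Rank1Residual.X12.O11
  Summit.BirchSwinnertonDyer.BirchSwinnertonDyer.Theses.RamifiedSevenEllipticUnits

namespace Summit.BirchSwinnertonDyer.BirchSwinnertonDyer.Theorems.RamifiedSevenEllipticUnits

/-! ## §1 Member level: `(R-EU)@7 at W ⟺ BSD(W, 7)` -/

section Member

variable {W : WeierstrassCurve ℚ} [W.IsElliptic] [W.IsGloballyMinimal]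

/-- **At a single member `W ∈ 𝒞₇`: `(R-EU)@7 at W ⟹ BSD(W, 7)`**, granted modularity, Gross–Zagier
I.(7.3), GZK and Cassels only — `O11.bsdp_of_halves` (p397xxx) fed with (R-tors)@W
(`strictTorsionSeven_of_GZK`, k7r-c4), (R-ctrl)@W (`StrictControlSeven_proof`, k7r-c4) and the frame
data at `7` (`frameDataSevenOfGZK_proof`). [cite: Miller2011LMS, §1 and Def. 1.1 (arXiv:1010.2431 p. 3)]
[cite: GrossZagier1986, Thm. I.(7.3)] [cite: Cassels1965ArithmeticVIII] -/
theorem bsdp_seven_of_ellipticUnitIndexAt [Fact (Nat.Prime 7)] (hmod : hasEntireLFunction_rat)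
    (hGZ : GrossZagier1986_thm_I_7_3) (hGZK : rank_eq_analyticRank_of_analyticRank_le_one)
    (hCassels : bsdRHS_eq_of_isIsogenous) (hW : ClassCSeven W)
    (h3 : RamifiedCMEllipticUnitIndexAt W 7) : BSDp W 7 := by
  obtain ⟨K, _, _, 𝔭, W', _, _, C, κ, γ, _, P, n, P', n', hF, hiso, hκ, hP, hgen, htors, hdiv, hndiv,
    hP', hgen', htors', hdiv', hndiv'⟩ := frameDataSevenOfGZK_proof hGZK W hW
  exact O11.bsdp_of_halves hmod hGZ hGZK hCassels (strictTorsionSeven_of_GZK hGZK W hW)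
    (StrictControlSeven_proof W hW) h3 hF hiso hW.2.2.1 hκ γ hP hgen htors hdiv hndiv hP' hgen' htors'
    hdiv' hndiv'

/-- **At every member `W ∈ 𝒞₇`: `(R-EU)@7 at W ⟺ BSD(W, 7)`** modulo modularity, Gross–Zagier
I.(7.3), GZK, Cassels (→ `bsdp_seven_of_ellipticUnitIndexAt`; ← gen 3's
`ellipticUnitIndexAt_seven_of_bsdp`, p430259). [cite: Miller2011LMS, §1 and Def. 1.1 (arXiv:1010.2431 p. 3)]
[cite: Cassels1965ArithmeticVIII] -/
theorem ellipticUnitIndexAt_seven_iff_bsdp [Fact (Nat.Prime 7)] (hmod : hasEntireLFunction_rat)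
    (hGZ : GrossZagier1986_thm_I_7_3) (hGZK : rank_eq_analyticRank_of_analyticRank_le_one)
    (hCassels : bsdRHS_eq_of_isIsogenous) (hW : ClassCSeven W) :
    RamifiedCMEllipticUnitIndexAt W 7 ↔ BSDp W 7 :=
  ⟨bsdp_seven_of_ellipticUnitIndexAt hmod hGZ hGZK hCassels hW,
    ellipticUnitIndexAt_seven_of_bsdp hCassels hmod hGZK hW⟩

end Member

/-! ## §2 Class level: crux #2 ⟺ `BSD(·, 7)` on 𝒞₇ ⟺ the rung leaf, modulo named facts only -/

/-- **`EllipticUnitIndexSeven ⟹ BSD(W, 7)` for every globally minimal `W ∈ 𝒞₇`**, granted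
modularity, Gross–Zagier I.(7.3), GZK, Cassels. [cite: Miller2011LMS, §1 and Def. 1.1 (arXiv:1010.2431 p. 3)]
[cite: GrossZagier1986, Thm. I.(7.3)] -/
theorem forall_bsdp_seven_of_ellipticUnitIndexSeven (hmod : hasEntireLFunction_rat)
    (hGZ : GrossZagier1986_thm_I_7_3) (hGZK : rank_eq_analyticRank_of_analyticRank_le_one)
    (hCassels : bsdRHS_eq_of_isIsogenous) (h₁ : EllipticUnitIndexSeven) :
    ∀ (W : WeierstrassCurve ℚ) [W.IsElliptic] [W.IsGloballyMinimal], ClassCSeven W → BSDp W 7 := by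
  intro W _ _ hW
  exact bsdp_seven_of_ellipticUnitIndexAt hmod hGZ hGZK hCassels hW (h₁ W hW)

/-- **`EllipticUnitIndexSeven ⟺ (BSD(W, 7) for every globally minimal W ∈ 𝒞₇)`** modulo exactly
modularity, Gross–Zagier I.(7.3), GZK and Cassels (← is gen 3's unconditional
`ellipticUnitIndexSeven_of_forall_bsdp_seven`). [cite: Miller2011LMS, §1 and Def. 1.1 (arXiv:1010.2431 p. 3)]
[cite: GrossZagier1986, Thm. I.(7.3)] -/
theorem ellipticUnitIndexSeven_iff_forall_bsdp_seven_of_GZK (hmod : hasEntireLFunction_rat)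
    (hGZ : GrossZagier1986_thm_I_7_3) (hGZK : rank_eq_analyticRank_of_analyticRank_le_one)
    (hCassels : bsdRHS_eq_of_isIsogenous) :
    EllipticUnitIndexSeven ↔
      ∀ (W : WeierstrassCurve ℚ) [W.IsElliptic] [W.IsGloballyMinimal], ClassCSeven W → BSDp W 7 :=
  ⟨forall_bsdp_seven_of_ellipticUnitIndexSeven hmod hGZ hGZK hCassels,
    ellipticUnitIndexSeven_of_forall_bsdp_seven⟩

/-- **`EllipticUnitIndexSeven ⟺ X12.CMRamifiedSeven` modulo the route's support item
`PublishedFactsSeven` alone** ((→) the route composition `cmRamifiedSeven_of_cruxes` (p411081) with crux #3 from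
`strictTorsionSeven_of_publishedFactsSeven` (k7r-c4 p430232) and crux #4 from `StrictControlSeven_proof`
— the same term as k7r-c3's `cmRamifiedSeven_of_ellipticUnitIndexSeven` (p431290); (←) gen 3's
`ellipticUnitIndexSeven_of_cmRamifiedSeven`, p430259): crux #2 of route K7r carries
EXACTLY the content of the rung leaf. [cite: Miller2011LMS, §1 and Def. 1.1 (arXiv:1010.2431 p. 3)] -/
theorem ellipticUnitIndexSeven_iff_cmRamifiedSeven_of_publishedFacts (h₅ : PublishedFactsSeven) :
    EllipticUnitIndexSeven ↔ Summit.BirchSwinnertonDyer.Rank1Residual.X12.CMRamifiedSeven :=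
  ⟨fun h₁ => cmRamifiedSeven_of_cruxes h₁ (strictTorsionSeven_of_publishedFactsSeven h₅)
      StrictControlSeven_proof h₅,
    ellipticUnitIndexSeven_of_cmRamifiedSeven⟩

/-- The same in Miller's currency at the single prime `7`, from the route's facts item (only its
conjuncts modularity, GZ I.(7.3), GZK, Cassels are used). [cite: Miller2011LMS, §1 and Def. 1.1 (arXiv:1010.2431 p. 3)] -/
theorem ellipticUnitIndexSeven_iff_forall_bsdp_seven_of_publishedFacts (h₅ : PublishedFactsSeven) :
    EllipticUnitIndexSeven ↔
      ∀ (W : WeierstrassCurve ℚ) [W.IsElliptic] [W.IsGloballyMinimal], ClassCSeven W → BSDp W 7 :=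
  ellipticUnitIndexSeven_iff_forall_bsdp_seven_of_GZK h₅.2.1 h₅.2.2.2.2.2.1 h₅.2.2.2.2.2.2.1
    h₅.2.2.2.2.2.2.2

end Summit.BirchSwinnertonDyer.BirchSwinnertonDyer.Theorems.RamifiedSevenEllipticUnits

end
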